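import Summits.Ventures.HodgeRepro.EngineFaces
import Summits.Ventures.HodgeRepro.FaceCriterion

/-!
# Completeness of the sealed engine's face list in degrees `≤ 8`

Blind re-derivation cell `pub-hodge-repro`, seat `typer` (gen 4).  Sits on p2's engine bridge
(`EngineBridge.lean`, `EngineFaces.lean`: masks as `Finset (Elt Γ)`, the table as a `Group`) and on
`FaceCriterion.lean`.

The sealed census rows (`FaceCensusRows8.lean`, `FaceCensusRows12.lean`) enumerate the faces
`Γ.faces` of a Cayley table `Γ : CMGaloisType n` and check `sumTwo` / `noConjugateCorners` for each of
them.  This file proves the CONVERSE for every table of order `n ≤ 8` (degrees 6 and 8, ROUTE.md §3.5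
(ii)): any four CM-type masks `T 0, …, T 3` such that every embedding lies in exactly two of them and
none of `T 1, T 2, T 3` is the conjugate `Γ.bar (T 0)` are the corners of a face `f ∈ Γ.faces` with
`f.1 = T 0`, up to reordering the corners (`engine_face_of_sumTwo`).  So the engine's face list — and
hence the sealed orbit census of its type squares — exhausts the `(eq2)`-quadruples without conjugate
corners in degrees 6 and 8.  In degree 12 the analogous statement is false (the patterns `(3,2,1)`,
`(2,2,2)` of ROUTE.md §3.4), and `isFace_of_sumTwo_of_card_le_eight` does not apply.

Also: `imageMask_lt` / `bar_lt` / `flipAt_lt` (the engine's operations stay below `2 ^ n`).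
-/

set_option autoImplicit false

open Finset
open scoped Pointwise symmDiff

namespace HodgeRepro

open Summit.Ventures.HodgeRepro

variable {n : ℕ}

/-! ### Bounds -/

/-- Images of masks are masks: `imageMask f T < 2 ^ n`. -/
theorem imageMask_lt (f : Fin n → Fin n) (T : ℕ) : FaceCensus.imageMask f T < 2 ^ n := by
  unfold FaceCensus.imageMask
  suffices h : ∀ (l : List (Fin n)) (acc : ℕ), acc < 2 ^ n →
      l.foldl (fun acc i => if FaceCensus.mem i T then acc ||| FaceCensus.bit (f i) else acc) acc <
        2 ^ n from
    h _ 0 (Nat.two_pow_pos n)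
  intro l
  induction l with
  | nil => intro acc h; simpa using h
  | cons i l ih =>
    intro acc h
    rw [List.foldl_cons]
    apply ih
    split_ifs
    · exact Nat.or_lt_two_pow h (EngineBridge.bit_lt (f i))
    · exact h

/-- The conjugate mask is a mask: `Γ.bar T < 2 ^ n`. -/
theorem bar_lt (Γ : FaceCensus.CMGaloisType n) (T : ℕ) : Γ.bar T < 2 ^ n :=
  imageMask_lt _ _

/-- A flip of a mask at a mask is a mask. -/
theorem flipAt_lt {π T : ℕ} (hπ : π < 2 ^ n) (hT : T < 2 ^ n) : FaceCensus.flipAt π T < 2 ^ n :=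
  Nat.xor_lt_two_pow hT hπ

/-! ### Completeness -/

/-- **Completeness of the engine's face list for `n ≤ 8`.**  Four CM-type masks `T 0, …, T 3 ∈ Γ.cmTypes`
such that every embedding `i : Fin n` lies in exactly two of them and none of `T 1, T 2, T 3` is the
conjugate `Γ.bar (T 0)` are the corners of an engine face `f = (T 0, π, π′) ∈ Γ.faces`, up to reordering:
`Γ.corners f` is a permutation of `[T 0, T 1, T 2, T 3]`. -/
theorem engine_face_of_sumTwo (Γ : FaceCensus.CMGaloisType n) [Fact (Γ.isCMGaloisType = true)]
    (hn : n ≤ 8) (T : Fin 4 → ℕ) (hT : ∀ k, T k ∈ Γ.cmTypes)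
    (hsum : ∀ i : Fin n, (univ.filter fun k => FaceCensus.mem i (T k) = true).card = 2)
    (hconj : ∀ k, k ≠ 0 → T k ≠ Γ.bar (T 0)) :
    ∃ f ∈ Γ.faces, f.1 = T 0 ∧ (Γ.corners f).Perm [T 0, T 1, T 2, T 3] := by
  have hc : IsComplexConj (EngineBridge.Elt.conj Γ) := EngineBridge.Elt.isComplexConj_conj Γ
  have hlt : ∀ k, T k < 2 ^ n := fun k => ((EngineBridge.mem_cmTypes Γ (T k)).1 (hT k)).1
  have hT' : ∀ k, IsCMType (EngineBridge.Elt.conj Γ) (EngineBridge.finsetOf Γ (T k)) := fun k =>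
    ((EngineBridge.isCMType_iff Γ (T k)).1 ((EngineBridge.mem_cmTypes Γ (T k)).1 (hT k)).2).2
  have hsum' : SumTwo fun k => EngineBridge.finsetOf Γ (T k) := by
    intro x
    have := hsum (EngineBridge.Elt.idx Γ x)
    simpa [EngineBridge.mem_finsetOf] using this
  have hconj' : ∀ k, k ≠ 0 →
      EngineBridge.finsetOf Γ (T k) ≠ EngineBridge.Elt.conj Γ • EngineBridge.finsetOf Γ (T 0) := by
    intro k hk h
    apply hconj k hk
    apply EngineBridge.finsetOf_injOn Γ (hlt k) (bar_lt Γ (T 0))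
    rw [EngineBridge.finsetOf_bar]
    exact h
  have hcard : Fintype.card (EngineBridge.Elt Γ) ≤ 8 := by
    have : Fintype.card (EngineBridge.Elt Γ) = n := Fintype.card_fin n
    omega
  obtain ⟨a, b, d, π, π', ha, hb, hd, hab, had, hbd, -, -, hππ', h1, h2, h3⟩ :=
    isFace_of_sumTwo_of_card_le_eight hc hT' hsum' hconj' hcard
  simp only [faceCorners] at h1 h2 h3
  have hfp : EngineBridge.finsetOf Γ (Γ.placeMask (EngineBridge.Elt.idx Γ π)) =
      place (EngineBridge.Elt.conj Γ) π := by
    rw [EngineBridge.finsetOf_placeMask]; rfl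
  have hfp' : EngineBridge.finsetOf Γ (Γ.placeMask (EngineBridge.Elt.idx Γ π')) =
      place (EngineBridge.Elt.conj Γ) π' := by
    rw [EngineBridge.finsetOf_placeMask]; rfl
  have hpp' : Γ.placeMask (EngineBridge.Elt.idx Γ π') ≠ Γ.placeMask (EngineBridge.Elt.idx Γ π) := by
    intro e
    apply hππ'
    rw [← hfp, ← e, hfp']
    exact mem_place_self _ π'
  have hf : (T 0, Γ.placeMask (EngineBridge.Elt.idx Γ π), Γ.placeMask (EngineBridge.Elt.idx Γ π')) ∈
      Γ.faces := by
    rw [EngineBridge.mem_faces]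
    exact ⟨hT 0, (EngineBridge.mem_places Γ _).2 ⟨_, rfl⟩, (EngineBridge.mem_places Γ _).2 ⟨_, rfl⟩,
      hpp'⟩
  refine ⟨_, hf, rfl, ?_⟩
  have e1 : T a = FaceCensus.flipAt (Γ.placeMask (EngineBridge.Elt.idx Γ π)) (Γ.bar (T 0)) := by
    apply EngineBridge.finsetOf_injOn Γ (hlt a)
      (flipAt_lt (EngineBridge.placeMask_lt Γ _) (bar_lt Γ _))
    rw [EngineBridge.finsetOf_flipAt, EngineBridge.finsetOf_bar, hfp]
    exact h1
  have e2 : T b = FaceCensus.flipAt (Γ.placeMask (EngineBridge.Elt.idx Γ π')) (Γ.bar (T 0)) := by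
    apply EngineBridge.finsetOf_injOn Γ (hlt b)
      (flipAt_lt (EngineBridge.placeMask_lt Γ _) (bar_lt Γ _))
    rw [EngineBridge.finsetOf_flipAt, EngineBridge.finsetOf_bar, hfp']
    exact h2
  have e3 : T d = FaceCensus.flipAt (Γ.placeMask (EngineBridge.Elt.idx Γ π'))
      (FaceCensus.flipAt (Γ.placeMask (EngineBridge.Elt.idx Γ π)) (T 0)) := by
    apply EngineBridge.finsetOf_injOn Γ (hlt d)
      (flipAt_lt (EngineBridge.placeMask_lt Γ _) (flipAt_lt (EngineBridge.placeMask_lt Γ _) (hlt 0)))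
    rw [EngineBridge.finsetOf_flipAt, EngineBridge.finsetOf_flipAt, hfp, hfp']
    exact h3
  show [T 0, FaceCensus.flipAt _ (Γ.bar (T 0)), FaceCensus.flipAt _ (Γ.bar (T 0)),
    FaceCensus.flipAt _ (FaceCensus.flipAt _ (T 0))].Perm _
  rw [← e1, ← e2, ← e3]
  exact perm_fin4 T a b d ha hb hd hab had hbd

end HodgeRepro
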